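import Literature.NumberTheory.Automorphic.ProModularDeRhamClassicalGL2QDyadicResidual
import Literature.NumberTheory.EllipticCurves.NewformGaloisRepOfEigenformProofs
import Literature.NumberTheory.EllipticCurves.HeckeRingCharacterEigenformProofs
import Literature.NumberTheory.EllipticCurves.NewformGaloisRepOfEigenformTwistProofs
import Literature.NumberTheory.GaloisRepresentations.FramedRepTwistEulerFactorProofs
import HarnessLib

/-!
# `Pan2022_proModularDeRhamClassical_GL2Q`: rendering (c) proved — from "arises from a cuspidal
# eigenform" to "is the Galois representation of a newform, up to a Tate twist"

Topic `Literature/NumberTheory/Automorphic`; a theorems-only sibling (no definition, no named fact;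
D-0026) of `ProModularDeRhamClassicalGL2Q` (the named fact `Pan2022_proModularDeRhamClassical_GL2Q`:
Pan, arXiv:2209.06366, Thm. 1.1.2 = Thm. 7.1.2, with Pan, Forum Math. Pi 10 (2022), Cor. 6.3.6 and
Paškūnas–Tung 2021, Thm. 7.1 — a pro-modular, regular de Rham, residually absolutely irreducible
`ρ : Γ_ℚ → GL₂(ℚ̄_p)` is, up to a Tate twist, the Galois representation of a newform), next to
`ProModularDeRhamClassicalGL2QOddPrime` and `ProModularDeRhamClassicalGL2QDyadicResidual`.

The printed theorem concludes "**`ρ` arises from a cuspidal eigenform of weight `k + 1`**"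
([Pan2022LocallyAnalyticII, Thm. 1.1.2]; §7.2.1, p. 117: "The classicality part of Theorem 7.1.2 is
equivalent with saying that `M_{k+1}(K^p) ⊗_{ℚ_p} E[λ'] ≠ 0`", `λ'` the eigensystem with
`ρ_{λ'} ≅ ρ`, `M_k(K^p)` the classical holomorphic forms of weight `k`, §5.5.5), for the Tate twist
of `ρ` with Hodge–Tate weights `0, k`, `k > 0`.  The named fact concludes, in the tree's vocabulary,
"some Tate twist `ρ ⊗ ε_p^m` is attached to a NEWFORM `f ∈ S_k(Γ₁(N))` away from `N p`"
(`IsNewform1 f ∧ IsGaloisRepOfNewform1 f ι_f {q ∣ N p} (ρ ⊗ ε_p^m)`).  The passage between the two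
— rendering (c) of the fact's module docstring: Atkin–Lehner–Li (eigenform ⟹ newform of level
dividing the level, same packet away from the level), Deligne's representation of that newform at
the `p`-adic embedding singled out by `ρ`, Chebotarev + Brauer–Nesbitt (`ρ ≅ ρ_f`), and the
Tate-twist bookkeeping of §7.2.1 — is PROVED here, granted ONE existing named fact as a hypothesis:
`Hida2000_thm326_exists_galoisRep` (Hida 2000, Thm. 3.26 (1) = Deligne's theorem for newforms at
every `p`-adic embedding; equivalent in the tree to Deligne–Serre 1974, Thm. 6.1 at every finite
place, `DeligneSerre1974.thm61_exists_adicGaloisRep_iff_Hida2000_thm326`).  The tree's one-place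
form `exists_padicGaloisRep_of_isNewform1` would not do: the embedding `K_f → ℚ̄_p` is forced by
the Frobenius traces of `ρ`.

* `FramedRep.scalar_eq_generalLinearGroup_scalar`, `FramedRep.isIrreducible_twist` — the twist
  `ρ ⊗ χ` (`FramedRep.twist`) of an irreducible framed representation is irreducible (the accepted
  `FramedRep.isIrreducible_of_twist`, stated for `Matrix.GeneralLinearGroup.scalar`, bridged to
  `FramedRep.scalar`).
* `newformTateTwist_of_eigenform_tateTwist` — **rendering (c)**: let `ρ : Γ_ℚ → GL₂(ℚ̄_p)` be
  continuous and irreducible, `χ₀ = ε_p^j` a Tate twist, `ι : ℚ̄_p ≃ ℂ`, and `g ∈ S_k(Γ₁(M))`,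
  `g ≠ 0`, `k ≥ 2`, a cuspidal eigenform (`g ∈ S_k(M, χ)`, `T_q g = a_q g` for `q ∤ M`) whose packet
  `ρ ⊗ χ₀` carries at all but finitely many places:
  `charpoly (ρ ⊗ χ₀)(Frob_q) = X² - ι⁻¹(a_q) X + ι⁻¹(χ(q) q^{k-1})` (arithmetic Frobenius).  Then
  the conclusion of `Pan2022_proModularDeRhamClassical_GL2Q` holds for `ρ`: some Tate twist of `ρ`
  is attached to a newform away from `N p` — by
  `exists_isNewform1_isGaloisRepOfNewform1_of_eigenform'` (`NewformGaloisRepOfEigenformProofs`)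
  for the semisimple `ρ ⊗ χ₀` and the conclusion-side Tate-twist invariance
  `newformTateTwist_of_tateTwist` of the fact file.  `newformTateTwist_of_eigenform` is the case
  `j = 0`.
* `Pan2022_proModularDeRhamClassical_GL2Q.of_eigenform` — hence **the named fact follows from
  `Hida2000_thm326_exists_galoisRep` and the printed statement read literally in the tree's
  complex-eigenform vocabulary**: "for every `ρ` satisfying the hypotheses of the fact there are
  `ι : ℚ̄_p ≃ ℂ`, a Tate twist `ρ ⊗ ε_p^j` and a non-zero cuspidal eigenform of some level `Γ₁(M)`
  and weight `k ≥ 2` whose packet `ρ ⊗ ε_p^j` carries at all but finitely many places" — which is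
  Pan's Thm. 1.1.2 (1) composed with Pan's Cor. 6.3.6 / Paškūnas–Tung Thm. 7.1 (pro-modular and
  irreducible ⟹ pro-cohomological) and the normalisation of §7.2.1 (both sides of which are proved
  in the fact file), nothing more: the hypothesis `hE` is that content verbatim, displayed as a
  binder (not a definition, not a named fact).  `…of_eigenform_dyadic_solvable` is the same with
  `hE` restricted to `p = 2` and residually solvable (dihedral) `ρ̄`, the instance to which the fact
  is equivalent granted X. Zhang / Tung / Serre (`Pan2022_proModularDeRhamClassical_GL2Q_iff_dyadic_solvable`).

* `newformTateTwist_of_heckeEigensystem_tateTwist`, `Pan2022_proModularDeRhamClassical_GL2Q.of_heckeEigensystem`,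
  `….of_heckeEigensystem_dyadic_solvable` — **the same with the complex eigenform and the choice of
  `ι : ℚ̄_p ≃ ℂ` removed from the interface**: the input is a `p`-ADIC HECKE EIGENSYSTEM
  `θ : 𝕋_ℤ(M, k) → ℚ̄_p` of the Hecke ring `𝕋_ℤ = ℤ[T_q, ⟨d⟩]` of `S_k(Γ₁(M))`, `k ≥ 2`
  (`heckeRing1`), such that `charpoly (ρ ⊗ ε_p^j)(Frob_q) = X² - θ(T_q) X + q^{k-1} θ(⟨q⟩)` at all
  but finitely many `q` (the tree's `(PadicHeckeAlgebra.frobPoly p M k q).map (lift θ)`) — literally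
  "the eigensystem `λ'` of the twist occurs in classical cusp forms of weight `k`", Pan's
  `M_k(K^p) ⊗ E[λ'] ≠ 0` up to the level-group dictionary — via
  `exists_isNewform1_isGaloisRepOfNewform1_of_ringHom_heckeRing1`
  (`HeckeRingCharacterEigenformProofs`: every character of `𝕋_ℤ` is the eigencharacter of an
  eigenform, Hida 2000 Thm. 3.17 / §3.2.1, proved from Shimura's duality and Deligne–Serre (2.7.2)).

* `newformTateTwist_of_heckeEigensystem_finiteTwist_tateTwist`,
  `Pan2022_proModularDeRhamClassical_GL2Q.of_heckeEigensystem_finiteTwist[_dyadic_solvable]` — **the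
  same up to a FINITE-ORDER twist**: the eigensystem `θ` may be that of `ρ ⊗ ε_p^j ⊗ ψ` for any
  continuous `ψ` with open kernel (the finite part of the central character which the normalisation
  `ρ_λ ≅ ρ^∨(1) = ρ ⊗ (det ρ)⁻¹ ε` of §7.1.4 — geometric Frobenius — introduces); the untwisting is
  done on the classical side (`NewformGaloisRepOfEigenformTwistProofs`: Kronecker–Weber avatar of
  `ψ⁻¹`, the newform of the twist by its Dirichlet character, Shimura Prop. 3.64 / Atkin–Li §3 — all
  proved).  This is rendering (c) of the fact file in full, and `hE` in its weakest literal form.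

What is NOT proved here (and is the irreducible XL content of the fact): `hE` itself — Emerton's
completed cohomology `H̃¹(K^p)` of the tower of modular curves as a `(GL₂(ℚ_p) × G_ℚ)`-module,
Pan's Cor. 6.3.6 (with Paškūnas–Tung at `p = 2, 3`) and Thm. 7.1.2 (geometric Sen theory and the
Fontaine operator on `𝒪^{la}_{K^p}`), and the comparison of the tree's all-degree completed-cohomology
Hecke algebra with Pan's `𝕋(K^p)` together with the `ℚ`-structure of `M_k` turning the `p`-adic
eigensystem `λ'` into a complex cuspidal eigenform (renderings (a), (c) of the fact's docstring).

## References

* L. Pan, *On locally analytic vectors of the completed cohomology of modular curves II*,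
  arXiv:2209.06366 (2022), Thm. 1.1.2 (= Thm. 7.1.2, p. 116), §5.5.5 (p. 75), §7.2.1 (p. 117).
  [Pan2022LocallyAnalyticII]
* L. Pan, Forum Math. Pi 10 (2022) = arXiv:2008.07099, Def. 6.1.2, Cor. 6.3.6. [Pan2022LocallyAnalytic]
* V. Paškūnas, S.-N. Tung, Forum Math. Sigma 9 (2021) e80, Thm. 7.1. [PaskunasTung2021]
* H. Hida, *Modular Forms and Galois Cohomology* (2000), Thm. 3.26 (1), pp. 151–152. [Hida2000]
* F. Diamond, J. Shurman, *A First Course in Modular Forms*, GTM 228 (2005), Thms. 5.8.2–5.8.3.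
  [DiamondShurman2005]
* P. Deligne, J.-P. Serre, Ann. Sci. ÉNS (4) 7 (1974), Lemme 3.2 (p. 513), Thm. 6.1 (p. 521).
  [DeligneSerreASENS1974]
-/

noncomputable section

open scoped MatrixGroups Matrix NumberField ModularForm
open NumberField IsDedekindDomain Field Filter CongruenceSubgroup Polynomial Rat.HeightOneSpectrum

/-! ### Twists of irreducible framed representations are irreducible (`FramedRep.twist` form) -/

namespace Literature.NumberTheory.GaloisRepresentations.FramedRep

section TwistIrreducible

variable {G : Type*} [Group G] [TopologicalSpace G] {A : Type*} [CommRing A] [TopologicalSpace A]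
  {n : ℕ}

/-- The scalar embedding `FramedRep.scalar A n : Aˣ → GL_n(A)` of `FramedRepTwist` is Mathlib's
`Matrix.GeneralLinearGroup.scalar (Fin n)` (both are `a ↦ a · 1`). [folklore] -/
theorem scalar_eq_generalLinearGroup_scalar (a : Aˣ) :
    scalar A n a = Matrix.GeneralLinearGroup.scalar (Fin n) a := by
  refine Units.ext ?_
  rw [coe_scalar_apply, Matrix.GeneralLinearGroup.coe_scalar, Matrix.scalar_apply,
    Matrix.algebraMap_eq_diagonal]
  rfl

/-- **The twist `ρ ⊗ χ` of an irreducible framed representation over a topological field is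
irreducible** — the accepted `FramedRep.isIrreducible_of_twist` (a subspace is `ρ ⊗ χ`-stable iff
it is `ρ`-stable, `χ(g)` being a unit) read for `FramedRep.twist`. [folklore] -/
theorem isIrreducible_twist {k : Type*} [Field k] [TopologicalSpace k] [IsTopologicalRing k]
    (ρ : FramedRep G k n) (χ : G →ₜ* kˣ) (hρ : ρ.toContinuousRep.IsIrreducible) :
    (ρ.twist χ).toContinuousRep.IsIrreducible :=
  isIrreducible_of_twist (fun g => by rw [twist_apply, scalar_eq_generalLinearGroup_scalar]) hρ

end TwistIrreducible

end Literature.NumberTheory.GaloisRepresentations.FramedRep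

namespace Literature.NumberTheory.Automorphic

open Literature.NumberTheory.GaloisRepresentations
open Literature.NumberTheory.EllipticCurves
open Literature.NumberTheory.EllipticCurves.ModularForms

variable {p : ℕ} [Fact p.Prime]

/-! ### Rendering (c): an eigenform for a Tate twist of `ρ` gives the conclusion of the fact -/

/-- **Rendering (c) of `Pan2022_proModularDeRhamClassical_GL2Q`, PROVED granted Deligne's theorem
at every `p`-adic embedding (`Hida2000_thm326_exists_galoisRep`).**  Let `ρ : Γ_ℚ → GL₂(ℚ̄_p)` be
continuous and irreducible, `χ₀ = ε_p^j` (pointwise) a Tate twist, `ι : ℚ̄_p ≃ ℂ` a field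
isomorphism, and `g ∈ S_k(Γ₁(M))`, `g ≠ 0`, `k ≥ 2`, a cuspidal eigenform — `g ∈ S_k(M, χ)` and
`T_q g = a_q g` for the primes `q ∤ M` — such that at all but finitely many places `ρ ⊗ χ₀` is
unramified with `charpoly (ρ ⊗ χ₀)(Frob_q) = X² - ι⁻¹(a_q) X + ι⁻¹(χ(q) q^{k-1})` (arithmetic
Frobenius): "`ρ ⊗ χ₀` arises from a cuspidal eigenform of weight `k`" in the dictionary `ι`
(Pan, §7.2.1: `M_k(K^p) ⊗ E[λ'] ≠ 0` with `ρ_{λ'} ≅ ρ ⊗ χ₀`).  Then the conclusion of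
`Pan2022_proModularDeRhamClassical_GL2Q` holds for `ρ`: there are a Tate twist `χ = ε_p^m`, a
newform `f ∈ S_k(Γ₁(N))` and `ι_f : K_f → ℚ̄_p` with `ρ ⊗ χ` attached to `f` away from `N p`.
Proof: `ρ ⊗ χ₀` is irreducible (`FramedRep.isIrreducible_twist`), hence semisimple; by
`exists_isNewform1_isGaloisRepOfNewform1_of_eigenform'` (Atkin–Lehner–Li, Hida's fact at the
embedding `ι⁻¹ ∘ (K_f ⊆ ℂ)`, Chebotarev + Brauer–Nesbitt) it is attached to a newform `f` of level
`N ∣ M` away from `N p`; the conclusion is blind to the Tate twist `χ₀`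
(`newformTateTwist_of_tateTwist`, §7.2.1).
[cite: Pan2022LocallyAnalyticII, Thm. 1.1.2 and §7.2.1 (p. 117 of arXiv:2209.06366)]
[cite: DiamondShurman2005, Thms. 5.8.2–5.8.3] [cite: Hida2000, Thm. 3.26 (1), pp. 151–152]
[cite: DeligneSerreASENS1974, Lemme 3.2 (p. 513)] -/
theorem newformTateTwist_of_eigenform_tateTwist (hH : Hida2000_thm326_exists_galoisRep)
    (ι : PadicAlgCl p ≃+* ℂ) (ρ : FramedGaloisRep ℚ (PadicAlgCl p) 2)
    (hirr : ρ.toGaloisRep.IsIrreducible)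
    {χ₀ : absoluteGaloisGroup ℚ →ₜ* (PadicAlgCl p)ˣ} {j : ℤ}
    (hχ₀ : ∀ σ, χ₀ σ = cyclotomicPadicAlgCl ℚ p σ ^ j)
    {M : ℕ} [NeZero M] {k : ℤ} (hk : 2 ≤ k) {g : CuspForm (Gamma1 M) k}
    {χ : DirichletCharacter ℂ M} (hgχ : g ∈ nebentypusSubspace M k χ) (hg0 : g ≠ 0) {a : ℕ → ℂ}
    (hT : ∀ (q : ℕ) (hq : q.Prime), ¬ q ∣ M →
      (haveI : NeZero q := ⟨hq.ne_zero⟩; ModularForms.heckeT (Gamma1 M) k q g) = a q • g)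
    (hc : ∀ᶠ w : HeightOneSpectrum (𝓞 ℚ) in cofinite,
      FramedGaloisRep.IsUnramifiedAt w (FramedRep.twist ρ χ₀) ∧
        FramedGaloisRep.HasFrobCharpolyAt w
          (X ^ 2 - C (ι.symm (a ((primesEquiv w : Nat.Primes) : ℕ))) * X +
            C (ι.symm (χ ((primesEquiv w : Nat.Primes) : ℕ) *
              (((primesEquiv w : Nat.Primes) : ℕ) : ℂ) ^ (k - 1)))) (FramedRep.twist ρ χ₀)) :
    ∃ (χ : absoluteGaloisGroup ℚ →ₜ* (PadicAlgCl p)ˣ) (m : ℤ),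
      (∀ σ, χ σ = cyclotomicPadicAlgCl ℚ p σ ^ m) ∧
      ∃ (N : ℕ) (_ : NeZero N) (k : ℤ) (f : CuspForm (Gamma1 N) k)
        (ιf : coeffCharField f →+* PadicAlgCl p),
        IsNewform1 f ∧ IsGaloisRepOfNewform1 f ιf {q | q ∣ N * p} (FramedRep.twist ρ χ) := by
  have hss : (FramedGaloisRep.toGaloisRep (FramedRep.twist ρ χ₀)).IsSemisimple := by
    haveI : (FramedGaloisRep.toGaloisRep (FramedRep.twist ρ χ₀)).toRepresentation.IsIrreducible :=
      FramedRep.isIrreducible_twist ρ χ₀ hirr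
    change
      (FramedGaloisRep.toGaloisRep (FramedRep.twist ρ χ₀)).toRepresentation.IsSemisimpleRepresentation
    infer_instance
  obtain ⟨N, hN, f, ιf, hf, hρf⟩ :=
    exists_isNewform1_isGaloisRepOfNewform1_of_eigenform' hH hk hgχ hg0 hT ι hss hc
  refine newformTateTwist_of_tateTwist ρ hχ₀ ⟨1, 0, fun σ => by simp, N, hN, k, f, ιf, hf, ?_⟩
  rwa [FramedRep.twist_one]

/-- **Rendering (c), untwisted case** (`j = 0` of `newformTateTwist_of_eigenform_tateTwist`): if
`ρ` itself is irreducible and carries, at all but finitely many places, the packet of a non-zero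
cuspidal eigenform of weight `k ≥ 2` in the dictionary `ι : ℚ̄_p ≃ ℂ`, then the conclusion of
`Pan2022_proModularDeRhamClassical_GL2Q` holds for `ρ` (with the trivial Tate twist), granted
`Hida2000_thm326_exists_galoisRep`.
[cite: Pan2022LocallyAnalyticII, Thm. 1.1.2 and §7.2.1 (p. 117)] [cite: Hida2000, Thm. 3.26 (1), pp. 151–152] -/
theorem newformTateTwist_of_eigenform (hH : Hida2000_thm326_exists_galoisRep)
    (ι : PadicAlgCl p ≃+* ℂ) (ρ : FramedGaloisRep ℚ (PadicAlgCl p) 2)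
    (hirr : ρ.toGaloisRep.IsIrreducible)
    {M : ℕ} [NeZero M] {k : ℤ} (hk : 2 ≤ k) {g : CuspForm (Gamma1 M) k}
    {χ : DirichletCharacter ℂ M} (hgχ : g ∈ nebentypusSubspace M k χ) (hg0 : g ≠ 0) {a : ℕ → ℂ}
    (hT : ∀ (q : ℕ) (hq : q.Prime), ¬ q ∣ M →
      (haveI : NeZero q := ⟨hq.ne_zero⟩; ModularForms.heckeT (Gamma1 M) k q g) = a q • g)
    (hc : ∀ᶠ w : HeightOneSpectrum (𝓞 ℚ) in cofinite,
      ρ.IsUnramifiedAt w ∧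
        ρ.HasFrobCharpolyAt w
          (X ^ 2 - C (ι.symm (a ((primesEquiv w : Nat.Primes) : ℕ))) * X +
            C (ι.symm (χ ((primesEquiv w : Nat.Primes) : ℕ) *
              (((primesEquiv w : Nat.Primes) : ℕ) : ℂ) ^ (k - 1))))) :
    ∃ (χ : absoluteGaloisGroup ℚ →ₜ* (PadicAlgCl p)ˣ) (m : ℤ),
      (∀ σ, χ σ = cyclotomicPadicAlgCl ℚ p σ ^ m) ∧
      ∃ (N : ℕ) (_ : NeZero N) (k : ℤ) (f : CuspForm (Gamma1 N) k)
        (ιf : coeffCharField f →+* PadicAlgCl p),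
        IsNewform1 f ∧ IsGaloisRepOfNewform1 f ιf {q | q ∣ N * p} (FramedRep.twist ρ χ) := by
  have hss : ρ.toGaloisRep.IsSemisimple := by
    haveI : ρ.toGaloisRep.toRepresentation.IsIrreducible := hirr
    change ρ.toGaloisRep.toRepresentation.IsSemisimpleRepresentation
    infer_instance
  obtain ⟨N, hN, f, ιf, hf, hρf⟩ :=
    exists_isNewform1_isGaloisRepOfNewform1_of_eigenform' hH hk hgχ hg0 hT ι hss hc
  exact ⟨1, 0, fun σ => by simp, N, hN, k, f, ιf, hf, by rwa [FramedRep.twist_one]⟩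

/-! ### The fact reduced to the printed statement in the complex-eigenform vocabulary -/

/-- **`Pan2022_proModularDeRhamClassical_GL2Q` from Deligne's theorem at every `p`-adic embedding
and Pan's theorem read literally in the tree's complex-eigenform vocabulary.**  Hypothesis `hE` is
the statement "for every prime `p` and every `ρ : Γ_ℚ → GL₂(ℚ̄_p)` satisfying the hypotheses of the
fact (residually absolutely irreducible, irreducible, almost everywhere unramified, de Rham above
`p` with distinct labelled weights, `p`-adically automorphic of some tame level) there are a field
isomorphism `ι : ℚ̄_p ≃ ℂ`, a Tate twist `ρ ⊗ ε_p^j` and a non-zero cuspidal eigenform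
`g ∈ S_k(Γ₁(M))`, `k ≥ 2` (`g ∈ S_k(M, χ)`, `T_q g = a_q g` for `q ∤ M`), whose packet `ρ ⊗ ε_p^j`
carries at all but finitely many places" — Pan's Thm. 1.1.2 (1) ("`ρ` arises from a cuspidal
eigenform of weight `k + 1`", for the Tate twist with Hodge–Tate weights `0, k`, `k > 0`, §7.2.1)
composed with Cor. 6.3.6 of the Forum Pi paper and Paškūnas–Tung's Thm. 7.1 (pro-modular and
irreducible ⟹ pro-cohomological, every `p`), i.e. the irreducible printed content of the fact,
displayed as a binder.  Granted `hE` and `Hida2000_thm326_exists_galoisRep`, the fact holds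
(`newformTateTwist_of_eigenform_tateTwist`).  Nothing is asserted about `hE`; it is NOT proved in
the tree.
[cite: Pan2022LocallyAnalyticII, Thm. 1.1.2 (= Thm. 7.1.2, p. 116) and §7.2.1 (p. 117)]
[cite: Pan2022LocallyAnalytic, Cor. 6.3.6] [cite: PaskunasTung2021, Thm. 7.1]
[cite: Hida2000, Thm. 3.26 (1), pp. 151–152] -/
theorem Pan2022_proModularDeRhamClassical_GL2Q.of_eigenform
    (hH : Hida2000_thm326_exists_galoisRep)
    (hE : ∀ (p : ℕ) [Fact p.Prime] (ρ : FramedGaloisRep ℚ (PadicAlgCl p) 2),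
      ρ.IsResiduallyAbsIrreducible → ρ.toGaloisRep.IsIrreducible →
      (∀ᶠ v : HeightOneSpectrum (𝓞 ℚ) in cofinite, ρ.IsUnramifiedAt v) →
      (∀ (v : HeightOneSpectrum (𝓞 ℚ)) (hv : ((p : ℕ) : 𝓞 ℚ) ∈ v.asIdeal),
        (PAdicHodge.fontainePstAdicCompletion v p hv).IsDeRhamFramed (ρ.toLocal v) ∧
        ∀ τ : v.adicCompletion ℚ →+* PadicAlgCl p, Continuous τ →
          (ρ.labelledHodgeTateWeightsAt v (PAdicHodge.fontainePstAdicCompletion v p hv).algebra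
            (PAdicHodge.fontainePstAdicCompletion v p hv).𝔅 τ).Nodup) →
      (∃ 𝒰 : BigHeckeGLn.TameLevel 2 ℚ p, 𝒰.IsPadicallyAutomorphic ρ) →
      ∃ (ι : PadicAlgCl p ≃+* ℂ) (χ₀ : absoluteGaloisGroup ℚ →ₜ* (PadicAlgCl p)ˣ) (j : ℤ),
        (∀ σ, χ₀ σ = cyclotomicPadicAlgCl ℚ p σ ^ j) ∧
        ∃ (M : ℕ) (_ : NeZero M) (k : ℤ) (_ : 2 ≤ k) (g : CuspForm (Gamma1 M) k)
          (χ : DirichletCharacter ℂ M) (a : ℕ → ℂ),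
          g ∈ nebentypusSubspace M k χ ∧ g ≠ 0 ∧
          (∀ (q : ℕ) (hq : q.Prime), ¬ q ∣ M →
            (haveI : NeZero q := ⟨hq.ne_zero⟩; ModularForms.heckeT (Gamma1 M) k q g) = a q • g) ∧
          ∀ᶠ w : HeightOneSpectrum (𝓞 ℚ) in cofinite,
            FramedGaloisRep.IsUnramifiedAt w (FramedRep.twist ρ χ₀) ∧
              FramedGaloisRep.HasFrobCharpolyAt w
                (X ^ 2 - C (ι.symm (a ((primesEquiv w : Nat.Primes) : ℕ))) * X +
                  C (ι.symm (χ ((primesEquiv w : Nat.Primes) : ℕ) *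
                    (((primesEquiv w : Nat.Primes) : ℕ) : ℂ) ^ (k - 1)))) (FramedRep.twist ρ χ₀)) :
    Pan2022_proModularDeRhamClassical_GL2Q := by
  intro p _ ρ hres hirr hunr hdR haut
  obtain ⟨ι, χ₀, j, hχ₀, M, _, k, hk, g, χ, a, hgχ, hg0, hT, hc⟩ := hE p ρ hres hirr hunr hdR haut
  exact newformTateTwist_of_eigenform_tateTwist hH ι ρ hirr hχ₀ hk hgχ hg0 hT hc

/-- **The same reduction for the dyadic residually-solvable instance**, to which the fact is
equivalent granted X. Zhang (odd `p`), Tung (`p = 2`, `ρ̄` non-solvable) and Serre's conjecture at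
`2` (`Pan2022_proModularDeRhamClassical_GL2Q_iff_dyadic_solvable`): it suffices to have the
eigenform statement `hE₂` for `p = 2` and `ρ` with residually SOLVABLE (dihedral) `ρ̄` (and `ρ`
odd, which is automatic, `IsPadicallyAutomorphic.isOdd`) — the case of the consumer crux
`DyadicOddResidue.ProModularClassicality`.
[cite: Pan2022LocallyAnalyticII, Thm. 1.1.2 (= Thm. 7.1.2)] [cite: PaskunasTung2021, Thm. 7.1]
[cite: Hida2000, Thm. 3.26 (1), pp. 151–152] -/
theorem Pan2022_proModularDeRhamClassical_GL2Q.of_eigenform_dyadic_solvable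
    (hX : XZhang2024_fontaineMazurGL2_tateTwist) (hT₂ : Tung2020_fontaineMazurGL2_two_tateTwist)
    (hS : ∀ (k : Type) [Field k] [TopologicalSpace k] [DiscreteTopology k],
      exists_newform_of_odd_irreducible (p := 2) (k := k))
    (hH : Hida2000_thm326_exists_galoisRep)
    (hE₂ : ∀ (ρ : FramedGaloisRep ℚ (PadicAlgCl 2) 2),
      ρ.IsResiduallyAbsIrreducible → IsSolvable ρ.residualRep.range →
      ρ.toGaloisRep.IsIrreducible → ρ.IsOdd →
      (∀ᶠ v : HeightOneSpectrum (𝓞 ℚ) in cofinite, ρ.IsUnramifiedAt v) →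
      (∀ (v : HeightOneSpectrum (𝓞 ℚ)) (hv : ((2 : ℕ) : 𝓞 ℚ) ∈ v.asIdeal),
        (PAdicHodge.fontainePstAdicCompletion v 2 hv).IsDeRhamFramed (ρ.toLocal v) ∧
        ∀ τ : v.adicCompletion ℚ →+* PadicAlgCl 2, Continuous τ →
          (ρ.labelledHodgeTateWeightsAt v (PAdicHodge.fontainePstAdicCompletion v 2 hv).algebra
            (PAdicHodge.fontainePstAdicCompletion v 2 hv).𝔅 τ).Nodup) →
      (∃ 𝒰 : BigHeckeGLn.TameLevel 2 ℚ 2, 𝒰.IsPadicallyAutomorphic ρ) →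
      ∃ (ι : PadicAlgCl 2 ≃+* ℂ) (χ₀ : absoluteGaloisGroup ℚ →ₜ* (PadicAlgCl 2)ˣ) (j : ℤ),
        (∀ σ, χ₀ σ = cyclotomicPadicAlgCl ℚ 2 σ ^ j) ∧
        ∃ (M : ℕ) (_ : NeZero M) (k : ℤ) (_ : 2 ≤ k) (g : CuspForm (Gamma1 M) k)
          (χ : DirichletCharacter ℂ M) (a : ℕ → ℂ),
          g ∈ nebentypusSubspace M k χ ∧ g ≠ 0 ∧
          (∀ (q : ℕ) (hq : q.Prime), ¬ q ∣ M →
            (haveI : NeZero q := ⟨hq.ne_zero⟩; ModularForms.heckeT (Gamma1 M) k q g) = a q • g) ∧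
          ∀ᶠ w : HeightOneSpectrum (𝓞 ℚ) in cofinite,
            FramedGaloisRep.IsUnramifiedAt w (FramedRep.twist ρ χ₀) ∧
              FramedGaloisRep.HasFrobCharpolyAt w
                (X ^ 2 - C (ι.symm (a ((primesEquiv w : Nat.Primes) : ℕ))) * X +
                  C (ι.symm (χ ((primesEquiv w : Nat.Primes) : ℕ) *
                    (((primesEquiv w : Nat.Primes) : ℕ) : ℂ) ^ (k - 1)))) (FramedRep.twist ρ χ₀)) :
    Pan2022_proModularDeRhamClassical_GL2Q := by
  refine Pan2022_proModularDeRhamClassical_GL2Q.of_dyadic_solvable hX hT₂ hS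
    fun ρ hres hsol hirr hodd hunr hdR haut => ?_
  obtain ⟨ι, χ₀, j, hχ₀, M, _, k, hk, g, χ, a, hgχ, hg0, hT, hc⟩ :=
    hE₂ ρ hres hsol hirr hodd hunr hdR haut
  exact newformTateTwist_of_eigenform_tateTwist hH ι ρ hirr hχ₀ hk hgχ hg0 hT hc


/-! ### The same with a `p`-adic Hecke eigensystem as input (no complex eigenform, no `ι`) -/

/-- **Rendering (c) from a `p`-adic Hecke eigensystem.**  Let `ρ : Γ_ℚ → GL₂(ℚ̄_p)` be continuous
and irreducible, `χ₀ = ε_p^j` a Tate twist, and `θ : 𝕋_ℤ(M, k) → ℚ̄_p` a ring homomorphism of the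
Hecke ring `ℤ[T_q, ⟨d⟩]` of `S_k(Γ₁(M))`, `k ≥ 2` (`heckeRing1 M k`) — a `p`-adic Hecke eigensystem
occurring in classical cusp forms — such that at all but finitely many places `ρ ⊗ χ₀` is
unramified with `charpoly (ρ ⊗ χ₀)(Frob_q) = X² - θ(T_q) X + q^{k-1} θ(⟨q⟩)` (arithmetic
Frobenius; `(PadicHeckeAlgebra.frobPoly p M k q).map (lift θ)`).  Then the conclusion of
`Pan2022_proModularDeRhamClassical_GL2Q` holds for `ρ`, granted `Hida2000_thm326_exists_galoisRep`:
`ρ ⊗ χ₀` is irreducible, hence semisimple, so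
`exists_isNewform1_isGaloisRepOfNewform1_of_ringHom_heckeRing1` (Hida's duality: `ι ∘ θ` is the
eigencharacter of a complex eigenform for any `ι : ℚ̄_p ≃ ℂ`; Atkin–Lehner–Li; Hida's Thm. 3.26 (1);
Chebotarev + Brauer–Nesbitt) attaches it to a newform away from `N p`, and the conclusion is blind
to the Tate twist (`newformTateTwist_of_tateTwist`).  This is Pan's "`M_{k+1}(K^p) ⊗ E[λ'] ≠ 0`
⟹ `ρ` arises from a cuspidal eigenform" (§7.2.1) read for an eigensystem of level `Γ₁(M)`.
[cite: Pan2022LocallyAnalyticII, Thm. 1.1.2 and §7.2.1 (p. 117)]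
[cite: Hida2000, Thm. 3.17, §3.2.1 (pp. 143–144) and Thm. 3.26 (1) (pp. 151–152)]
[cite: DeligneSerreASENS1974, Lemme 3.2 (p. 513)] -/
theorem newformTateTwist_of_heckeEigensystem_tateTwist (hH : Hida2000_thm326_exists_galoisRep)
    (ρ : FramedGaloisRep ℚ (PadicAlgCl p) 2) (hirr : ρ.toGaloisRep.IsIrreducible)
    {χ₀ : absoluteGaloisGroup ℚ →ₜ* (PadicAlgCl p)ˣ} {j : ℤ}
    (hχ₀ : ∀ σ, χ₀ σ = cyclotomicPadicAlgCl ℚ p σ ^ j)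
    {M : ℕ} [NeZero M] {n : ℕ} (θ : heckeRing1 M (n + 2) →+* PadicAlgCl p)
    (hc : ∀ᶠ w : HeightOneSpectrum (𝓞 ℚ) in cofinite,
      FramedGaloisRep.IsUnramifiedAt w (FramedRep.twist ρ χ₀) ∧
        FramedGaloisRep.HasFrobCharpolyAt w
          ((PadicHeckeAlgebra.frobPoly p M (n + 2) (primesEquiv w)).map
            (PadicHeckeAlgebra.lift p θ : PadicHeckeAlgebra p M (n + 2) →+* PadicAlgCl p))
          (FramedRep.twist ρ χ₀)) :
    ∃ (χ : absoluteGaloisGroup ℚ →ₜ* (PadicAlgCl p)ˣ) (m : ℤ),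
      (∀ σ, χ σ = cyclotomicPadicAlgCl ℚ p σ ^ m) ∧
      ∃ (N : ℕ) (_ : NeZero N) (k : ℤ) (f : CuspForm (Gamma1 N) k)
        (ιf : coeffCharField f →+* PadicAlgCl p),
        IsNewform1 f ∧ IsGaloisRepOfNewform1 f ιf {q | q ∣ N * p} (FramedRep.twist ρ χ) := by
  have hss : (FramedGaloisRep.toGaloisRep (FramedRep.twist ρ χ₀)).IsSemisimple := by
    haveI : (FramedGaloisRep.toGaloisRep (FramedRep.twist ρ χ₀)).toRepresentation.IsIrreducible :=
      FramedRep.isIrreducible_twist ρ χ₀ hirr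
    change
      (FramedGaloisRep.toGaloisRep (FramedRep.twist ρ χ₀)).toRepresentation.IsSemisimpleRepresentation
    infer_instance
  obtain ⟨N, hN, -, f, ιf, hf, hρf, -, -⟩ :=
    exists_isNewform1_isGaloisRepOfNewform1_of_ringHom_heckeRing1 hH θ hss hc
  refine newformTateTwist_of_tateTwist ρ hχ₀ ⟨1, 0, fun σ => by simp, N, hN, _, f, ιf, hf, ?_⟩
  rwa [FramedRep.twist_one]

/-- **`Pan2022_proModularDeRhamClassical_GL2Q` from Deligne's theorem at every `p`-adic embedding and
Pan's theorem read literally with a `p`-adic Hecke eigensystem as output.**  Hypothesis `hE` is: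
"for every prime `p` and every `ρ : Γ_ℚ → GL₂(ℚ̄_p)` satisfying the hypotheses of the fact there are
a Tate twist `ρ ⊗ ε_p^j`, a level `M`, a weight `k ≥ 2` and a ring homomorphism
`θ : 𝕋_ℤ(M, k) → ℚ̄_p` of the Hecke ring of `S_k(Γ₁(M))` with
`charpoly (ρ ⊗ ε_p^j)(Frob_q) = X² - θ(T_q) X + q^{k-1} θ(⟨q⟩)` at all but finitely many `q`" —
Pan's Thm. 1.1.2 (1) in the form of §7.2.1 ("`M_{k+1}(K^p) ⊗ E[λ'] ≠ 0`": the eigensystem `λ'`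
with `ρ_{λ'} ≅ ρ` occurs in classical forms of weight `k + 1`) composed with Cor. 6.3.6 /
Paškūnas–Tung Thm. 7.1 and the normalisation of §7.2.1, up to the dictionary between Pan's level
`K^p K_p` and `Γ₁(M)` — the irreducible printed content of the fact, displayed as a binder (not a
definition, not a named fact, NOT proved in the tree).  Granted `hE` and
`Hida2000_thm326_exists_galoisRep` the fact holds (`newformTateTwist_of_heckeEigensystem_tateTwist`).
[cite: Pan2022LocallyAnalyticII, Thm. 1.1.2 (= Thm. 7.1.2, p. 116) and §7.2.1 (p. 117)]
[cite: Pan2022LocallyAnalytic, Cor. 6.3.6] [cite: PaskunasTung2021, Thm. 7.1]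
[cite: Hida2000, Thm. 3.26 (1), pp. 151–152] -/
theorem Pan2022_proModularDeRhamClassical_GL2Q.of_heckeEigensystem
    (hH : Hida2000_thm326_exists_galoisRep)
    (hE : ∀ (p : ℕ) [Fact p.Prime] (ρ : FramedGaloisRep ℚ (PadicAlgCl p) 2),
      ρ.IsResiduallyAbsIrreducible → ρ.toGaloisRep.IsIrreducible →
      (∀ᶠ v : HeightOneSpectrum (𝓞 ℚ) in cofinite, ρ.IsUnramifiedAt v) →
      (∀ (v : HeightOneSpectrum (𝓞 ℚ)) (hv : ((p : ℕ) : 𝓞 ℚ) ∈ v.asIdeal),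
        (PAdicHodge.fontainePstAdicCompletion v p hv).IsDeRhamFramed (ρ.toLocal v) ∧
        ∀ τ : v.adicCompletion ℚ →+* PadicAlgCl p, Continuous τ →
          (ρ.labelledHodgeTateWeightsAt v (PAdicHodge.fontainePstAdicCompletion v p hv).algebra
            (PAdicHodge.fontainePstAdicCompletion v p hv).𝔅 τ).Nodup) →
      (∃ 𝒰 : BigHeckeGLn.TameLevel 2 ℚ p, 𝒰.IsPadicallyAutomorphic ρ) →
      ∃ (χ₀ : absoluteGaloisGroup ℚ →ₜ* (PadicAlgCl p)ˣ) (j : ℤ),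
        (∀ σ, χ₀ σ = cyclotomicPadicAlgCl ℚ p σ ^ j) ∧
        ∃ (M : ℕ) (_ : NeZero M) (n : ℕ) (θ : heckeRing1 M (n + 2) →+* PadicAlgCl p),
          ∀ᶠ w : HeightOneSpectrum (𝓞 ℚ) in cofinite,
            FramedGaloisRep.IsUnramifiedAt w (FramedRep.twist ρ χ₀) ∧
              FramedGaloisRep.HasFrobCharpolyAt w
                ((PadicHeckeAlgebra.frobPoly p M (n + 2) (primesEquiv w)).map
                  (PadicHeckeAlgebra.lift p θ : PadicHeckeAlgebra p M (n + 2) →+* PadicAlgCl p))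
                (FramedRep.twist ρ χ₀)) :
    Pan2022_proModularDeRhamClassical_GL2Q := by
  intro p _ ρ hres hirr hunr hdR haut
  obtain ⟨χ₀, j, hχ₀, M, _, n, θ, hc⟩ := hE p ρ hres hirr hunr hdR haut
  exact newformTateTwist_of_heckeEigensystem_tateTwist hH ρ hirr hχ₀ θ hc

/-- **The same reduction for the dyadic residually-solvable instance** (`p = 2`, `ρ̄` with solvable
image, `ρ` odd — the case of the consumer crux `DyadicOddResidue.ProModularClassicality`), to which
the fact is equivalent granted X. Zhang / Tung / Serre
(`Pan2022_proModularDeRhamClassical_GL2Q_iff_dyadic_solvable`).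
[cite: Pan2022LocallyAnalyticII, Thm. 1.1.2 (= Thm. 7.1.2)] [cite: PaskunasTung2021, Thm. 7.1]
[cite: Hida2000, Thm. 3.26 (1), pp. 151–152] -/
theorem Pan2022_proModularDeRhamClassical_GL2Q.of_heckeEigensystem_dyadic_solvable
    (hX : XZhang2024_fontaineMazurGL2_tateTwist) (hT₂ : Tung2020_fontaineMazurGL2_two_tateTwist)
    (hS : ∀ (k : Type) [Field k] [TopologicalSpace k] [DiscreteTopology k],
      exists_newform_of_odd_irreducible (p := 2) (k := k))
    (hH : Hida2000_thm326_exists_galoisRep)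
    (hE₂ : ∀ (ρ : FramedGaloisRep ℚ (PadicAlgCl 2) 2),
      ρ.IsResiduallyAbsIrreducible → IsSolvable ρ.residualRep.range →
      ρ.toGaloisRep.IsIrreducible → ρ.IsOdd →
      (∀ᶠ v : HeightOneSpectrum (𝓞 ℚ) in cofinite, ρ.IsUnramifiedAt v) →
      (∀ (v : HeightOneSpectrum (𝓞 ℚ)) (hv : ((2 : ℕ) : 𝓞 ℚ) ∈ v.asIdeal),
        (PAdicHodge.fontainePstAdicCompletion v 2 hv).IsDeRhamFramed (ρ.toLocal v) ∧
        ∀ τ : v.adicCompletion ℚ →+* PadicAlgCl 2, Continuous τ →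
          (ρ.labelledHodgeTateWeightsAt v (PAdicHodge.fontainePstAdicCompletion v 2 hv).algebra
            (PAdicHodge.fontainePstAdicCompletion v 2 hv).𝔅 τ).Nodup) →
      (∃ 𝒰 : BigHeckeGLn.TameLevel 2 ℚ 2, 𝒰.IsPadicallyAutomorphic ρ) →
      ∃ (χ₀ : absoluteGaloisGroup ℚ →ₜ* (PadicAlgCl 2)ˣ) (j : ℤ),
        (∀ σ, χ₀ σ = cyclotomicPadicAlgCl ℚ 2 σ ^ j) ∧
        ∃ (M : ℕ) (_ : NeZero M) (n : ℕ) (θ : heckeRing1 M (n + 2) →+* PadicAlgCl 2),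
          ∀ᶠ w : HeightOneSpectrum (𝓞 ℚ) in cofinite,
            FramedGaloisRep.IsUnramifiedAt w (FramedRep.twist ρ χ₀) ∧
              FramedGaloisRep.HasFrobCharpolyAt w
                ((PadicHeckeAlgebra.frobPoly 2 M (n + 2) (primesEquiv w)).map
                  (PadicHeckeAlgebra.lift 2 θ : PadicHeckeAlgebra 2 M (n + 2) →+* PadicAlgCl 2))
                (FramedRep.twist ρ χ₀)) :
    Pan2022_proModularDeRhamClassical_GL2Q := by
  refine Pan2022_proModularDeRhamClassical_GL2Q.of_dyadic_solvable hX hT₂ hS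
    fun ρ hres hsol hirr hodd hunr hdR haut => ?_
  obtain ⟨χ₀, j, hχ₀, M, _, n, θ, hc⟩ := hE₂ ρ hres hsol hirr hodd hunr hdR haut
  exact newformTateTwist_of_heckeEigensystem_tateTwist hH ρ hirr hχ₀ θ hc


/-! ### The same up to a finite-order twist (Atkin–Li untwisting on the classical side) -/

/-- **Rendering (c) from a `p`-adic Hecke eigensystem of a Tate twist TIMES A FINITE-ORDER
CHARACTER.**  Let `ρ : Γ_ℚ → GL₂(ℚ̄_p)` be continuous and irreducible, `χ₀ = ε_p^j` a Tate twist,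
`ψ : Γ_ℚ → ℚ̄_pˣ` continuous with open kernel (a finite-order character — e.g. the finite part of the
central character, which the normalisation `ρ_λ ≅ ρ^∨(1) = ρ ⊗ (det ρ)⁻¹ ε` of
[Pan2022LocallyAnalyticII, §7.1.4 (geometric Frobenius) and §7.2.1] introduces), and
`θ : 𝕋_ℤ(M, k) → ℚ̄_p` a ring homomorphism of the Hecke ring of `S_k(Γ₁(M))`, `k ≥ 2`, such that at
all but finitely many places `(ρ ⊗ χ₀) ⊗ ψ` is unramified with
`charpoly ((ρ ⊗ χ₀) ⊗ ψ)(Frob_q) = X² - θ(T_q) X + q^{k-1} θ(⟨q⟩)`.  Then the conclusion of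
`Pan2022_proModularDeRhamClassical_GL2Q` holds for `ρ`, granted `Hida2000_thm326_exists_galoisRep`:
`ρ ⊗ χ₀` is irreducible; by `exists_isNewform1_isGaloisRepOfNewform1_of_ringHom_heckeRing1_twist`
(`NewformGaloisRepOfEigenformTwistProofs`: Hida's duality, Kronecker–Weber for `ψ⁻¹`, the newform
of the twist by its Dirichlet character — Shimura Prop. 3.64 / Atkin–Li §3 — Hida's Thm. 3.26 (1),
Chebotarev + Brauer–Nesbitt) `ρ ⊗ χ₀` is attached to a newform away from `N p`; the conclusion is
blind to `χ₀` (`newformTateTwist_of_tateTwist`).  This is rendering (c) of the fact file in full: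
"undoing `ψ = ε_p^j χ₀` replaces `f` by the newform of `f ⊗ χ₀⁻¹` (Atkin–Li 1978, §3)".
[cite: Pan2022LocallyAnalyticII, §7.1.4, Thm. 1.1.2 and §7.2.1 (p. 117)] [cite: AtkinLi1978, §3]
[cite: Hida2000, Thm. 3.17, §3.2.1 and Thm. 3.26 (1)] -/
theorem newformTateTwist_of_heckeEigensystem_finiteTwist_tateTwist
    (hH : Hida2000_thm326_exists_galoisRep)
    (ρ : FramedGaloisRep ℚ (PadicAlgCl p) 2) (hirr : ρ.toGaloisRep.IsIrreducible)
    {χ₀ : absoluteGaloisGroup ℚ →ₜ* (PadicAlgCl p)ˣ} {j : ℤ}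
    (hχ₀ : ∀ σ, χ₀ σ = cyclotomicPadicAlgCl ℚ p σ ^ j)
    (ψ : absoluteGaloisGroup ℚ →ₜ* (PadicAlgCl p)ˣ)
    (hψ : IsOpen ((ψ.toMonoidHom.ker : Subgroup (absoluteGaloisGroup ℚ)) :
      Set (absoluteGaloisGroup ℚ)))
    {M : ℕ} [NeZero M] {n : ℕ} (θ : heckeRing1 M (n + 2) →+* PadicAlgCl p)
    (hc : ∀ᶠ w : HeightOneSpectrum (𝓞 ℚ) in cofinite,
      FramedGaloisRep.IsUnramifiedAt w (FramedRep.twist (FramedRep.twist ρ χ₀) ψ) ∧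
        FramedGaloisRep.HasFrobCharpolyAt w
          ((PadicHeckeAlgebra.frobPoly p M (n + 2) (primesEquiv w)).map
            (PadicHeckeAlgebra.lift p θ : PadicHeckeAlgebra p M (n + 2) →+* PadicAlgCl p))
          (FramedRep.twist (FramedRep.twist ρ χ₀) ψ)) :
    ∃ (χ : absoluteGaloisGroup ℚ →ₜ* (PadicAlgCl p)ˣ) (m : ℤ),
      (∀ σ, χ σ = cyclotomicPadicAlgCl ℚ p σ ^ m) ∧
      ∃ (N : ℕ) (_ : NeZero N) (k : ℤ) (f : CuspForm (Gamma1 N) k)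
        (ιf : coeffCharField f →+* PadicAlgCl p),
        IsNewform1 f ∧ IsGaloisRepOfNewform1 f ιf {q | q ∣ N * p} (FramedRep.twist ρ χ) := by
  have hirr₀ : (FramedGaloisRep.toGaloisRep (FramedRep.twist ρ χ₀)).IsIrreducible :=
    FramedRep.isIrreducible_twist ρ χ₀ hirr
  obtain ⟨N, hN, f, ιf, hf, hρf⟩ :=
    exists_isNewform1_isGaloisRepOfNewform1_of_ringHom_heckeRing1_twist hH θ hirr₀ ψ hψ hc
  refine newformTateTwist_of_tateTwist ρ hχ₀ ⟨1, 0, fun σ => by simp, N, hN, _, f, ιf, hf, ?_⟩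
  rwa [FramedRep.twist_one]

/-- **`Pan2022_proModularDeRhamClassical_GL2Q` from Deligne's theorem at every `p`-adic embedding and
the WEAKEST literal reading of Pan's theorem**: hypothesis `hE` asks, for every `ρ` with the
hypotheses of the fact, for a Tate twist `ε_p^j`, a continuous character `ψ` with open kernel, a
level `M`, a weight `k ≥ 2` and a `p`-adic Hecke eigensystem `θ : 𝕋_ℤ(M, k) → ℚ̄_p` carried almost
everywhere by `ρ ⊗ ε_p^j ⊗ ψ` — what [Pan2022LocallyAnalyticII, Thm. 1.1.2 (1) with §7.2.1] and
[Pan2022LocallyAnalytic, Cor. 6.3.6] / [PaskunasTung2021, Thm. 7.1] give for the eigensystem `λ` of a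
pro-modular `ρ` in the normalisation `ρ_λ ≅ ρ ⊗ (det ρ)⁻¹ ε` of §7.1.4 (there `det ρ`, de Rham, is
a Tate twist of a finite-order character), up to the dictionary between Pan's level `K^p K_p` and
`Γ₁(M)`; displayed as a binder (not a definition, not a named fact, NOT proved in the tree).
[cite: Pan2022LocallyAnalyticII, Thm. 1.1.2 (= Thm. 7.1.2, p. 116), §7.1.4 and §7.2.1 (p. 117)]
[cite: Pan2022LocallyAnalytic, Cor. 6.3.6] [cite: PaskunasTung2021, Thm. 7.1] [cite: AtkinLi1978, §3]
[cite: Hida2000, Thm. 3.26 (1), pp. 151–152] -/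
theorem Pan2022_proModularDeRhamClassical_GL2Q.of_heckeEigensystem_finiteTwist
    (hH : Hida2000_thm326_exists_galoisRep)
    (hE : ∀ (p : ℕ) [Fact p.Prime] (ρ : FramedGaloisRep ℚ (PadicAlgCl p) 2),
      ρ.IsResiduallyAbsIrreducible → ρ.toGaloisRep.IsIrreducible →
      (∀ᶠ v : HeightOneSpectrum (𝓞 ℚ) in cofinite, ρ.IsUnramifiedAt v) →
      (∀ (v : HeightOneSpectrum (𝓞 ℚ)) (hv : ((p : ℕ) : 𝓞 ℚ) ∈ v.asIdeal),
        (PAdicHodge.fontainePstAdicCompletion v p hv).IsDeRhamFramed (ρ.toLocal v) ∧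
        ∀ τ : v.adicCompletion ℚ →+* PadicAlgCl p, Continuous τ →
          (ρ.labelledHodgeTateWeightsAt v (PAdicHodge.fontainePstAdicCompletion v p hv).algebra
            (PAdicHodge.fontainePstAdicCompletion v p hv).𝔅 τ).Nodup) →
      (∃ 𝒰 : BigHeckeGLn.TameLevel 2 ℚ p, 𝒰.IsPadicallyAutomorphic ρ) →
      ∃ (χ₀ : absoluteGaloisGroup ℚ →ₜ* (PadicAlgCl p)ˣ) (j : ℤ),
        (∀ σ, χ₀ σ = cyclotomicPadicAlgCl ℚ p σ ^ j) ∧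
        ∃ (ψ : absoluteGaloisGroup ℚ →ₜ* (PadicAlgCl p)ˣ),
          IsOpen ((ψ.toMonoidHom.ker : Subgroup (absoluteGaloisGroup ℚ)) :
            Set (absoluteGaloisGroup ℚ)) ∧
        ∃ (M : ℕ) (_ : NeZero M) (n : ℕ) (θ : heckeRing1 M (n + 2) →+* PadicAlgCl p),
          ∀ᶠ w : HeightOneSpectrum (𝓞 ℚ) in cofinite,
            FramedGaloisRep.IsUnramifiedAt w (FramedRep.twist (FramedRep.twist ρ χ₀) ψ) ∧
              FramedGaloisRep.HasFrobCharpolyAt w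
                ((PadicHeckeAlgebra.frobPoly p M (n + 2) (primesEquiv w)).map
                  (PadicHeckeAlgebra.lift p θ : PadicHeckeAlgebra p M (n + 2) →+* PadicAlgCl p))
                (FramedRep.twist (FramedRep.twist ρ χ₀) ψ)) :
    Pan2022_proModularDeRhamClassical_GL2Q := by
  intro p _ ρ hres hirr hunr hdR haut
  obtain ⟨χ₀, j, hχ₀, ψ, hψ, M, _, n, θ, hc⟩ := hE p ρ hres hirr hunr hdR haut
  exact newformTateTwist_of_heckeEigensystem_finiteTwist_tateTwist hH ρ hirr hχ₀ ψ hψ θ hc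

/-- **The same reduction for the dyadic residually-solvable instance** (`p = 2`, solvable
`ρ̄`-image, `ρ` odd — the consumer crux `DyadicOddResidue.ProModularClassicality`), to which the fact
is equivalent granted X. Zhang / Tung / Serre (`Pan2022_proModularDeRhamClassical_GL2Q_iff_dyadic_solvable`).
[cite: Pan2022LocallyAnalyticII, Thm. 1.1.2 (= Thm. 7.1.2)] [cite: PaskunasTung2021, Thm. 7.1]
[cite: AtkinLi1978, §3] [cite: Hida2000, Thm. 3.26 (1), pp. 151–152] -/
theorem Pan2022_proModularDeRhamClassical_GL2Q.of_heckeEigensystem_finiteTwist_dyadic_solvable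
    (hX : XZhang2024_fontaineMazurGL2_tateTwist) (hT₂ : Tung2020_fontaineMazurGL2_two_tateTwist)
    (hS : ∀ (k : Type) [Field k] [TopologicalSpace k] [DiscreteTopology k],
      exists_newform_of_odd_irreducible (p := 2) (k := k))
    (hH : Hida2000_thm326_exists_galoisRep)
    (hE₂ : ∀ (ρ : FramedGaloisRep ℚ (PadicAlgCl 2) 2),
      ρ.IsResiduallyAbsIrreducible → IsSolvable ρ.residualRep.range →
      ρ.toGaloisRep.IsIrreducible → ρ.IsOdd →
      (∀ᶠ v : HeightOneSpectrum (𝓞 ℚ) in cofinite, ρ.IsUnramifiedAt v) →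
      (∀ (v : HeightOneSpectrum (𝓞 ℚ)) (hv : ((2 : ℕ) : 𝓞 ℚ) ∈ v.asIdeal),
        (PAdicHodge.fontainePstAdicCompletion v 2 hv).IsDeRhamFramed (ρ.toLocal v) ∧
        ∀ τ : v.adicCompletion ℚ →+* PadicAlgCl 2, Continuous τ →
          (ρ.labelledHodgeTateWeightsAt v (PAdicHodge.fontainePstAdicCompletion v 2 hv).algebra
            (PAdicHodge.fontainePstAdicCompletion v 2 hv).𝔅 τ).Nodup) →
      (∃ 𝒰 : BigHeckeGLn.TameLevel 2 ℚ 2, 𝒰.IsPadicallyAutomorphic ρ) →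
      ∃ (χ₀ : absoluteGaloisGroup ℚ →ₜ* (PadicAlgCl 2)ˣ) (j : ℤ),
        (∀ σ, χ₀ σ = cyclotomicPadicAlgCl ℚ 2 σ ^ j) ∧
        ∃ (ψ : absoluteGaloisGroup ℚ →ₜ* (PadicAlgCl 2)ˣ),
          IsOpen ((ψ.toMonoidHom.ker : Subgroup (absoluteGaloisGroup ℚ)) :
            Set (absoluteGaloisGroup ℚ)) ∧
        ∃ (M : ℕ) (_ : NeZero M) (n : ℕ) (θ : heckeRing1 M (n + 2) →+* PadicAlgCl 2),
          ∀ᶠ w : HeightOneSpectrum (𝓞 ℚ) in cofinite,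
            FramedGaloisRep.IsUnramifiedAt w (FramedRep.twist (FramedRep.twist ρ χ₀) ψ) ∧
              FramedGaloisRep.HasFrobCharpolyAt w
                ((PadicHeckeAlgebra.frobPoly 2 M (n + 2) (primesEquiv w)).map
                  (PadicHeckeAlgebra.lift 2 θ : PadicHeckeAlgebra 2 M (n + 2) →+* PadicAlgCl 2))
                (FramedRep.twist (FramedRep.twist ρ χ₀) ψ)) :
    Pan2022_proModularDeRhamClassical_GL2Q := by
  refine Pan2022_proModularDeRhamClassical_GL2Q.of_dyadic_solvable hX hT₂ hS
    fun ρ hres hsol hirr hodd hunr hdR haut => ?_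
  obtain ⟨χ₀, j, hχ₀, ψ, hψ, M, _, n, θ, hc⟩ := hE₂ ρ hres hsol hirr hodd hunr hdR haut
  exact newformTateTwist_of_heckeEigensystem_finiteTwist_tateTwist hH ρ hirr hχ₀ ψ hψ θ hc

end Literature.NumberTheory.Automorphic

end
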